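import Summits.QuantumFields.YangMills.Theorems.LangevinControlUVOSLegsFromFemtoAndGapStubAssemblyUniformBoundMain
import Summits.QuantumFields.YangMills.Theorems.LangevinControlUVOSLegsFromFemtoAndGapStubAssemblyCompactness
import HarnessLib

/-!
# Soft OS-assembly toolkit VII: subsequential limits of the lattice `n`-point distributions on `⁰𝒮`

Helper file for stub `stub_assembly` of crux `OSLegsFromFemtoAndGap` (stmt-QuantumFields-9367, line
`dlr-collar-transfer`).  Toolkit II (`exists_subseq_clm_limit`: a diagonal subsequence plus Hahn–Banach) is fed
with toolkit VI-c (`latticeDist_norm_le_of_momentBounds`: the `a`-uniform E0′-type bound on `⁰𝒮ₙ`, `n ≥ 2`):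
along ANY sequence of couplings/tori inside the regime of VI-c there is ONE subsequence along which every
`n`-point distribution (`n ≥ 2`) converges on `⁰𝒮ₙ`, the limits being continuous linear functionals on all of
`𝒮ₙ` obeying the same bound `5 Kⁿ · schwartzNorm (10 n)` (`exists_subseq_latticeDist_limit`).  This is the
existence half of the soft OS legs (the candidate Schwinger functions); their properties are the later toolkits.
-/

noncomputable section

open scoped SchwartzMap BigOperators
open MeasureTheory Filter Topology
open Literature.MathematicalPhysics.QuantumFieldTheory Literature.MathematicalPhysics.QuantumLattice
open Literature.MathematicalPhysics.AQFT
open Literature.Probability.LatticeModels (box Site)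
open Summit.QuantumFields.YangMills.Cruxes.OSLegsFromFemtoAndGap.DlrCollarTransfer (MomentBounds)

namespace Summit.QuantumFields.YangMills.Theorems.OSLegsFromFemtoAndGap

local notation "E4" => EuclideanSpace ℝ (Fin 4)

/-- The seminorm budget of toolkit VI-c is dominated by `5 · schwartzNorm (10 n)`. -/
theorem seminorm_budget_le_schwartzNorm {X : Type*} [NormedAddCommGroup X] [NormedSpace ℝ X] (n : ℕ)
    (F : 𝓢(X, ℂ)) :
    SchwartzMap.seminorm ℂ 0 (4 * n) F + SchwartzMap.seminorm ℂ (6 * n) (4 * n) F +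
        SchwartzMap.seminorm ℂ 0 0 F + SchwartzMap.seminorm ℂ (6 * n) 0 F +
        SchwartzMap.seminorm ℂ (10 * n) 0 F ≤ 5 * schwartzNorm (10 * n) F := by
  have h1 := seminorm_le_schwartzNorm (m := 10 * n) (k := 0) (l := 4 * n) (by omega) (by omega) F
  have h2 := seminorm_le_schwartzNorm (m := 10 * n) (k := 6 * n) (l := 4 * n) (by omega) (by omega) F
  have h3 := seminorm_le_schwartzNorm (m := 10 * n) (k := 0) (l := 0) (by omega) (by omega) F
  have h4 := seminorm_le_schwartzNorm (m := 10 * n) (k := 6 * n) (l := 0) (by omega) (by omega) F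
  have h5 := seminorm_le_schwartzNorm (m := 10 * n) (k := 10 * n) (l := 0) (by omega) (by omega) F
  linarith

variable {G : Type} [Group G] [TopologicalSpace G] [IsTopologicalGroup G] [CompactSpace G]
  [MeasurableSpace G] [BorelSpace G]

/-- **Subsequential limits of the lattice `n`-point distributions on `⁰𝒮`.**  Under `MomentBounds`, for any
sequences of couplings `βs` and torus half-sides `Ls` inside the regime of toolkit VI-c (`β ≥ β₄`,
`0 < a(β) ≤ min 1 ℓ₄`, `L ≥ 14`, `L ≥ a(β)⁻²`) there are a subsequence `φ` and continuous linear functionals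
`S n` on `𝒮((ℝ⁴)ⁿ)` with `‖S n F‖ ≤ 5 Kⁿ schwartzNorm (10 n) F` such that, for every `n ≥ 2` and every
`F ∈ ⁰𝒮ₙ`, the centred lattice distributions of `tr F²` converge to `S n F` along `φ`. -/
theorem exists_subseq_latticeDist_limit (r : LatticeRep G) {a : ℝ → ℝ} (hMB : MomentBounds G r a) :
    ∃ (β₄ ℓ₄ K : ℝ), 0 < ℓ₄ ∧ 0 ≤ K ∧ ∀ (βs : ℕ → ℝ) (Ls : ℕ → ℕ),
      (∀ k, β₄ ≤ βs k) → (∀ k, 0 < a (βs k)) → (∀ k, a (βs k) ≤ 1) → (∀ k, a (βs k) ≤ ℓ₄) →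
      (∀ k, 14 ≤ Ls k) → (∀ k, (a (βs k))⁻¹ * (a (βs k))⁻¹ ≤ Ls k) →
      ∃ φ : ℕ → ℕ, StrictMono φ ∧ ∃ S : (n : ℕ) → (𝓢((Fin n → E4), ℂ) →L[ℂ] ℂ),
        (∀ n F, ‖S n F‖ ≤ 5 * K ^ n * schwartzNorm (10 * n) F) ∧
        ∀ n, 2 ≤ n → ∀ F : 𝓢((Fin n → E4), ℂ), IsOffDiagonal F →
          Tendsto (fun k => latticeDist r.ρ (βs (φ k)) (Ls (φ k)) (a (βs (φ k))) r.curvature.F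
            (wilsonTorusMean r.ρ (βs (φ k)) (Ls (φ k)) r.curvature.F) n F) atTop (𝓝 (S n F)) := by
  classical
  obtain ⟨β₄, ℓ₄, K, hℓ, hK, H⟩ := latticeDist_norm_le_of_momentBounds r hMB
  refine ⟨β₄, ℓ₄, K, hℓ, hK, ?_⟩
  intro βs Ls hβ ha ha1 haℓ hL hLa
  -- the lattice distributions (zero below arity 2) and the submodules `⁰𝒮ₙ`
  obtain ⟨T, hT⟩ : ∃ T : (n : ℕ) → ℕ → (𝓢((Fin n → E4), ℂ) →L[ℂ] ℂ),
      T = fun n k => if 2 ≤ n then latticeDist r.ρ (βs k) (Ls k) (a (βs k)) r.curvature.F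
        (wilsonTorusMean r.ρ (βs k) (Ls k) r.curvature.F) n else 0 := ⟨_, rfl⟩
  let M : (n : ℕ) → Submodule ℂ 𝓢((Fin n → E4), ℂ) := fun n =>
    { carrier := {F | IsOffDiagonal F}
      add_mem' := fun hF hG => hF.add hG
      zero_mem' := isOffDiagonal_zero
      smul_mem' := fun c _ hF => hF.smul c }
  have hM : ∀ n (F : 𝓢((Fin n → E4), ℂ)), F ∈ M n ↔ IsOffDiagonal F := fun n F => Iff.rfl
  -- the uniform bound of toolkit VI-c in the currency of toolkit II
  have hbound : ∀ n k, ∀ F ∈ M n, ‖T n k F‖ ≤ 5 * K ^ n * schwartzNorm (10 * n) F := by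
    intro n k F hF
    rw [hM] at hF
    by_cases hn : 2 ≤ n
    · rw [hT]; dsimp only; rw [if_pos hn]
      calc _ ≤ K ^ n * (SchwartzMap.seminorm ℂ 0 (4 * n) F + SchwartzMap.seminorm ℂ (6 * n) (4 * n) F +
            SchwartzMap.seminorm ℂ 0 0 F + SchwartzMap.seminorm ℂ (6 * n) 0 F +
            SchwartzMap.seminorm ℂ (10 * n) 0 F) :=
            H (βs k) (hβ k) (ha k) (ha1 k) (haℓ k) (Ls k) (hL k) (hLa k) n hn F hF
        _ ≤ K ^ n * (5 * schwartzNorm (10 * n) F) := by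
            gcongr
            exact seminorm_budget_le_schwartzNorm n F
        _ = 5 * K ^ n * schwartzNorm (10 * n) F := by ring
    · rw [hT]; dsimp only; rw [if_neg hn]; simp only [zero_apply, norm_zero]
      exact mul_nonneg (by positivity) (schwartzNorm_nonneg _ _)
  obtain ⟨φ, hφ, S, hS, hconv⟩ := exists_subseq_clm_limit (X := fun n : ℕ => Fin n → E4) T M
    (fun n => 10 * n) (fun n => 5 * K ^ n) (fun n => by positivity) hbound
  refine ⟨φ, hφ, S, hS, fun n hn F hF => ?_⟩
  have h := hconv n F ((hM n F).2 hF)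
  rw [hT] at h
  dsimp only at h
  simp only [if_pos hn] at h
  exact h

end Summit.QuantumFields.YangMills.Theorems.OSLegsFromFemtoAndGap

end
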